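import Mathlib
import HarnessLib
import Summits.HubbardSuperconductivity.HubbardSuperconductivity.Theorems.KLProgrammeKLRegimeSplitSlotsV17F2
import Summits.HubbardSuperconductivity.HubbardSuperconductivity.Theorems.KLProgrammeKLRegimeSplitRowZeroMajorant
import Summits.HubbardSuperconductivity.HubbardSuperconductivity.Theorems.KLProgrammeKLRegimeSplitLegCountFlow
import Summits.HubbardSuperconductivity.HubbardSuperconductivity.Theorems.KLProgrammeKLRegimeSplitThermalLayer
import Summits.HubbardSuperconductivity.HubbardSuperconductivity.Theorems.KLProgrammeKLRegimeSplitValueIdentification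
import Summits.HubbardSuperconductivity.HubbardSuperconductivity.Theorems.KLProgrammeKLRegimeEngineThermalBand

/-!
# K3 ENGINE-FLOW child (gen 8, stmt-HubbardSuperconductivity-20437 `KLRegimeEngineV17F2`), stub (c) `stub_engine_step_values`,
# conjunct (E5-F)ₙ `IsoTupleL1AtV17F … n` at the INDUCTIVE scales: the DOOR (plan g17 (R41b), KL STATUS 2026-08-27 12:48Z, owner k3c2-p2)
# (cell gate-hubbard-kl, seat hubbard-kl-k3c2-p2 g8, value/(T) lane)

(E5-F)ₙ (`…SplitSlotsV17F` l.221) says: for every `B ≥ 0` bounding the `↑↓` values `λ_n[K_n](k₁,k₂,k₃)` on the BARE ball `klBall L μ 0`,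
every isotropic re-sectorisation `m ≥ n` of the scale-`n` one-shot quartic kernel `𝒱_n[K_n]`, every admissible iso 4-tuple `Ω` and every
pinned point, `fixedTupleL1 β 3 (klIsoKernelAt … (K_n) n m) Ω x₁ ≤ CF·B + CF·(Klam U)²`.  Mechanism = the scale-0 pattern
(`isoTupleL1AtS_zero_of_torusSum`, p3 g6): a SINGLE-TUPLE size in value units `a·U + b·(Klam U)²` (the tower's export at level `n`,
INPUT here) plus B-ABSORPTION of the linear-in-`U` part through ONE lower bound `θ·U ≤ |λ_n[K_n](k₁,k₂,k₃)|` at a bare-ball triple.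
At scale 0 that lower bound came from the explicit second-order step; at the inductive scales it comes from the VALUE LANE: the
scale-0 ultraviolet clause of (E2-F2)₀ and the telescoped cross-frame (E2″-F) increments `j = 1 … n`, whose per-scale rows
(`gainBar + eremBar(j−1) + thermalBar j + legDressBarQ2·legSliceCountT(K_j) + frameShiftBar j`) are SUMMABLE along the extended ladder
`n ≤ n_β + 1` — pp gains frozen off the pair class (`GeoConsts.WF`), ph gains `≤ CF`, `eremBar_sum_le`, the thermal sum
`klth_thermalBar_sum_le_succ` (`7/3·CF·(Klam U)²`), the FLOWING leg count `legDressBarQ2_countT_flow_sum_le` (`≤ 20·…`), `sum_frameShiftBar_le`.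

* §1 **`isoTupleL1AtV17F_of_fixedTuple_le`** — the B-absorption door: `hfix` (single iso-tuple size `≤ a·U + b·(Klam U)²` at every `m ≥ n`) +
  `θ·U ≤ ‖λ_n[K_n](k₁,k₂,k₃)‖` at ONE bare-ball triple + `a ≤ θ·CF`, `b ≤ CF` ⟹ `IsoTupleL1AtV17F … n` (any `G P`);
* §2 **`norm_pairAmplitude_flow_sub_le_of_increments`** — `‖𝒞_n[K_n](Qm;k,k′) − U‖ ≤ initDevBar + legDressBarQ2(0,4) + Σ_{1≤j≤n} row_j`
  from the (E2-F2)₀ uv clause and `PairValueIncrementAtV17F … j`, `1 ≤ j ≤ n`; `…_ge_…` the lower bound;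
* §3 **`sum_pairValueRow_le`** — `Σ_{1≤j≤n} row_j(Qm;k,k′) ≤ pairValueRowSum…` (closed form, below) for `n ≤ n_β + 1`, `4⁻¹ < |Qm|_𝕋`
  and the frame-rate law `frameDist K_{j+1} K_j ≤ κ·Λ_j` (`j < n`, `κ ≤ 1/32`); `frameDist_klFlowFrameU_succ_le` discharges the rate law
  from (I-F jets) (`FlowPieceJetsAt`, the history's renorm slot) and ONE smallness `R.Gfr 0·|U| ≤ κ·klE0`;
* §1′ (appended, (R46)(β)) **`isoTupleL1AtV17F_of_fixedTuple_le_linear`** (+ `_linear_of_flowValues`, `_linear_hist`): ONE condition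
  `a + b·Klam²·U ≤ θ·CF` instead of `a ≤ θ·CF ∧ b ≤ CF` — a `P`/`R`-closed `b` is paid by `U`-smallness;
* §4 **`isoTupleL1AtV17F_of_fixedTuple_le_of_flowValues`** — the assembled door: tower line + (E2-F2)₀ uv clause + increments `j ≤ n` +
  two bare-ball points `q, q₃` with `4⁻¹ < |q + q₃|_𝕋` + rate law + ONE `U₀`-type smallness (the accumulated rows `≤ U/2`) ⟹ (E5-F)ₙ;
  **`isoTupleL1AtV17F_of_fixedTuple_le_hist`** — the same keyed on the stub's history `HistP klPredsV17F2 … 0 n` (uv clause and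
  increments `j < n` read from it) plus the CURRENT (E2″-F)ₙ (derived before (E5-F)ₙ in the (c) assembly `klvrF2_stepValues_of_parts`).

What (E5-F)ₙ still needs after this file: the tower's single-tuple line `hfix` ((b)-F export at level n, r2d-p2 / k3c2-p3; the label-SUMMED
`KernelNormsV4`/`KernelNormsWt4` cannot give it), the two ball points (geometry of `klBall L μ 0` on `klWindowC`), and the smallness line
(a `U₀`/volume door).  Everything here is proved; no definitions, no named facts; nothing about the model is asserted; nothing asserts superconductivity.
-/

noncomputable section

namespace Summit.HubbardSuperconductivity.HubbardSuperconductivity.Theorems.KLRegimeSplit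

set_option linter.dupNamespace false -- summit = problem name (single-conjunct summit), D-0017

open Real Finset Literature.MathematicalPhysics.QuantumLattice Literature.Probability.LatticeModels
open Summit.HubbardSuperconductivity.HubbardSuperconductivity.Theorems.KLProgrammeLegKernels
open Summit.HubbardSuperconductivity.HubbardSuperconductivity.Theorems.EngineV8

section Model

variable {L M : ℕ} [NeZero L] [NeZero M] {G : GeoConsts} {P : SplitConsts} {Q : EngConsts} {R : RenConsts} {β U μ : ℝ} {n : ℕ}

/-! ## §1 B-absorption: (E5-F)ₙ from a single-tuple size in value units and ONE value lower bound -/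

/-- **(E5-F)ₙ from a single-tuple line and one value lower bound.**  If every isotropic re-sectorisation `m ≥ n` of the scale-`n`
one-shot quartic kernel has fixed-tuple size `≤ a·U + b·(Klam U)²`, if `θ·U ≤ ‖λ_n[K_n](k₁,k₂,k₃)‖` at some bare-ball triple, and if
`a ≤ θ·CF`, `b ≤ CF`, then `IsoTupleL1AtV17F … n`: any admissible `B` is `≥ θ·U`, which absorbs the linear part. -/
theorem isoTupleL1AtV17F_of_fixedTuple_le (hU : 0 < U) (hCF : 0 ≤ G.CF) {a b θ : ℝ}
    (hfix : ∀ m : ℕ, n ≤ m → ∀ Ω ∈ bgmSectorSet L M (klIsoFamily L M β μ (klFlowFrameU L M β U μ n) klE0 m) 4,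
      ∀ x₁ : SpaceTimeIdx L M,
        fixedTupleL1 L M β 3 (klIsoKernelAt L M β U μ (klFlowFrameU L M β U μ n) n m) Ω x₁ ≤ a * U + b * (P.Klam * U) ^ 2)
    {k₁ k₂ k₃ : TorusSite 2 L} (hk₁ : k₁ ∈ klBall L μ 0) (hk₂ : k₂ ∈ klBall L μ 0) (hk₃ : k₃ ∈ klBall L μ 0)
    (hlow : θ * U ≤ ‖klQuarticValue L M β U μ (klFlowFrameU L M β U μ n) n 0 1 k₁ k₂ k₃‖)
    (ha : a ≤ θ * G.CF) (hb : b ≤ G.CF) :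
    IsoTupleL1AtV17F L M G P β U μ n := by
  intro B _hB hvals m hm Ω hΩ x₁
  have hθB : θ * U ≤ B := hlow.trans (hvals k₁ hk₁ k₂ hk₂ k₃ hk₃)
  have h1 := hfix m hm Ω hΩ x₁
  have hsq : 0 ≤ (P.Klam * U) ^ 2 := sq_nonneg _
  have h2 : a * U ≤ G.CF * B :=
    calc a * U ≤ θ * G.CF * U := mul_le_mul_of_nonneg_right ha hU.le
      _ = G.CF * (θ * U) := by ring
      _ ≤ G.CF * B := mul_le_mul_of_nonneg_left hθB hCF
  have h3 : b * (P.Klam * U) ^ 2 ≤ G.CF * (P.Klam * U) ^ 2 := mul_le_mul_of_nonneg_right hb hsq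
  linarith

/-! ## §2 The value lane's lower bound: scale-0 uv clause + telescoped cross-frame increments -/

/-- **Telescoped (E2″-F) increments**: from the scale-`0` ultraviolet clause `‖𝒞₀[K₀](Qm;k,k′) − U‖ ≤ initDevBar + legDressBarQ2(0,4)` and
`PairValueIncrementAtV17F … j` for `1 ≤ j ≤ n`, on the bare ball
`‖𝒞_n[K_n](Qm;k,k′) − U‖ ≤ initDevBar G U + legDressBarQ2 G P Q U 0 4 + Σ_{j ∈ [1,n]} row_j(Qm;k,k′)`. -/
theorem norm_pairAmplitude_flow_sub_le_of_increments (n : ℕ)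
    (h0 : ∀ Qm : TorusSite 2 L, ∀ k ∈ klBall L μ 0, ∀ k' ∈ klBall L μ 0,
      ‖klPairAmplitude L M β U μ (klFlowFrameU L M β U μ 0) 0 Qm k k' - (U : ℂ)‖ ≤ initDevBar G U + legDressBarQ2 G P Q U 0 4)
    (hincr : ∀ j : ℕ, 1 ≤ j → j ≤ n → PairValueIncrementAtV17F L M G P Q β U μ j)
    (Qm : TorusSite 2 L) {k k' : TorusSite 2 L} (hk : k ∈ klBall L μ 0) (hk' : k' ∈ klBall L μ 0) :
    ‖klPairAmplitude L M β U μ (klFlowFrameU L M β U μ n) n Qm k k' - (U : ℂ)‖ ≤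
      initDevBar G U + legDressBarQ2 G P Q U 0 4 +
        ∑ j ∈ Ico 1 (n + 1), (gainBar G P U j (klTorusNorm L Qm) (klTorusNorm L (k - k')) (klTorusNorm L (k + k' - Qm)) +
          eremBar G P Q U β L (j - 1) + thermalBar G P U β j +
            legDressBarQ2 G P Q U j (legSliceCountT L β μ (klFlowFrameU L M β U μ j) j ![k', Qm - k', Qm - k, k]) +
              frameShiftBar P Q U j) := by
  induction n with
  | zero => simpa using h0 Qm k hk k' hk'
  | succ n ih =>
    have ih' := ih (fun j hj1 hjn => hincr j hj1 (hjn.trans (Nat.le_succ n)))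
    have hstep := hincr (n + 1) (by omega) le_rfl (by omega) Qm k hk k' hk'
    rw [Finset.sum_Ico_succ_top (by omega : 1 ≤ n + 1)]
    have htri := norm_sub_le_norm_sub_add_norm_sub (klPairAmplitude L M β U μ (klFlowFrameU L M β U μ (n + 1)) (n + 1) Qm k k')
      (klPairAmplitude L M β U μ (klFlowFrameU L M β U μ (n + 1 - 1)) (n + 1 - 1) Qm k k') (U : ℂ)
    simp only [show n + 1 - 1 = n from rfl] at htri hstep ⊢
    linarith

/-- **The value lower bound**: under the same data, `U − (initDevBar + legDressBarQ2(0,4) + Σ row_j) ≤ ‖𝒞_n[K_n](Qm;k,k′)‖`. -/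
theorem norm_pairAmplitude_flow_ge_of_increments (hU : 0 ≤ U) (n : ℕ)
    (h0 : ∀ Qm : TorusSite 2 L, ∀ k ∈ klBall L μ 0, ∀ k' ∈ klBall L μ 0,
      ‖klPairAmplitude L M β U μ (klFlowFrameU L M β U μ 0) 0 Qm k k' - (U : ℂ)‖ ≤ initDevBar G U + legDressBarQ2 G P Q U 0 4)
    (hincr : ∀ j : ℕ, 1 ≤ j → j ≤ n → PairValueIncrementAtV17F L M G P Q β U μ j)
    (Qm : TorusSite 2 L) {k k' : TorusSite 2 L} (hk : k ∈ klBall L μ 0) (hk' : k' ∈ klBall L μ 0) :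
    U - (initDevBar G U + legDressBarQ2 G P Q U 0 4 +
        ∑ j ∈ Ico 1 (n + 1), (gainBar G P U j (klTorusNorm L Qm) (klTorusNorm L (k - k')) (klTorusNorm L (k + k' - Qm)) +
          eremBar G P Q U β L (j - 1) + thermalBar G P U β j +
            legDressBarQ2 G P Q U j (legSliceCountT L β μ (klFlowFrameU L M β U μ j) j ![k', Qm - k', Qm - k, k]) +
              frameShiftBar P Q U j)) ≤
      ‖klPairAmplitude L M β U μ (klFlowFrameU L M β U μ n) n Qm k k'‖ := by
  have h := norm_pairAmplitude_flow_sub_le_of_increments (G := G) (P := P) (Q := Q) n h0 hincr Qm hk hk'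
  have hUn : ‖(U : ℂ)‖ = U := by rw [Complex.norm_real, Real.norm_eq_abs, abs_of_nonneg hU]
  have htri := norm_sub_norm_le (U : ℂ) (klPairAmplitude L M β U μ (klFlowFrameU L M β U μ n) n Qm k k')
  rw [norm_sub_rev] at htri
  linarith

/-! ## §3 The rows are summable along the extended ladder `n ≤ n_β + 1` (off the pair class) -/

/-- `Ioc 0 n = Ico 1 (n+1)` in `ℕ`. -/
theorem Ioc_zero_eq_Ico_one (n : ℕ) : Finset.Ioc 0 n = Finset.Ico 1 (n + 1) := by
  ext j; simp only [Finset.mem_Ioc, Finset.mem_Ico]; omega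

/-- `Ico 1 (n+1) ⊆ range (n+1)`. -/
theorem Ico_one_subset_range (n : ℕ) : Finset.Ico 1 (n + 1) ⊆ Finset.range (n + 1) := by
  intro j hj; simp only [Finset.mem_Ico] at hj; simp only [Finset.mem_range]; omega

/-- **The summed rows of the cross-frame (E2″-F) increments, CLOSED FORM** — for `n ≤ n_β + 1`, `Qm` off the pair class at every scale
(`4⁻¹ < |Qm|_𝕋`, so the pp gains are the frozen ones of `GeoConsts.WF`), and the frame-rate law along the flow (`j < n`):
`Σ_{1≤j≤n} row_j ≤ 3·CF·(Klam U)² + [(cloc·Klam²·(1−4^{−θ})⁻¹ + 2·CR·Klam³·|U|)·U² + Σ_{j<n} CL β j / L] + (7/3)·CF·(Klam U)²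
 + 20·CR·((Klam U)² + (Klam|U|)³) + (4/3)·CR·(Klam U)²`. -/
theorem sum_pairValueRow_le (hG : G.WF) (hP : P.WF) (hQ : Q.WF)
    (hn : n ≤ nScales β + 1) (Qm k k' : TorusSite 2 L) (hQm : 4⁻¹ < klTorusNorm L Qm) {κ : ℝ} (hκ0 : 0 ≤ κ) (hκ : κ ≤ 1 / 32)
    (hrate : ∀ j < n, frameDist (klFlowFrameU L M β U μ (j + 1)) (klFlowFrameU L M β U μ j) ≤ κ * klScale klE0 j) :
    ∑ j ∈ Ico 1 (n + 1), (gainBar G P U j (klTorusNorm L Qm) (klTorusNorm L (k - k')) (klTorusNorm L (k + k' - Qm)) +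
        eremBar G P Q U β L (j - 1) + thermalBar G P U β j +
          legDressBarQ2 G P Q U j (legSliceCountT L β μ (klFlowFrameU L M β U μ j) j ![k', Qm - k', Qm - k, k]) +
            frameShiftBar P Q U j) ≤
      3 * G.CF * (P.Klam * U) ^ 2 +
        ((G.cloc * P.Klam ^ 2 * (1 - (4 : ℝ) ^ (-G.θ))⁻¹ + 2 * Q.CR * P.Klam ^ 3 * |U|) * U ^ 2 + ∑ j ∈ range n, Q.CL β j / L) +
          7 / 3 * (G.CF * (P.Klam * U) ^ 2) + 20 * (Q.CR * ((P.Klam * U) ^ 2 + (P.Klam * |U|) ^ 3)) +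
            4 / 3 * (Q.CR * (P.Klam * U) ^ 2) := by
  have hG' := hG
  obtain ⟨-, -, -, -, -, -, -, -, -, -, -, -, hph0, hCF, hphs, hpps, -⟩ := hG'
  have hK : 0 ≤ P.Klam := zero_le_one.trans hP.1
  have hCR : 0 ≤ Q.CR := hQ.2.1
  have hsub := Ico_one_subset_range n
  simp only [Finset.sum_add_distrib]
  -- (1) gains
  have hgain : ∑ j ∈ Ico 1 (n + 1), gainBar G P U j (klTorusNorm L Qm) (klTorusNorm L (k - k')) (klTorusNorm L (k + k' - Qm)) ≤
      3 * G.CF * (P.Klam * U) ^ 2 := by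
    simp only [gainBar, ← Finset.mul_sum, Finset.sum_add_distrib]
    have hpp : ∑ j ∈ Ico 1 (n + 1), G.ppGain j (klTorusNorm L Qm) ≤ G.CF := by
      rw [← Ioc_zero_eq_Ico_one]
      exact hpps (klTorusNorm L Qm) 0 n (by norm_num at hQm ⊢; exact hQm)
    have hph : ∀ ρ : ℝ, 0 ≤ ρ → ∑ j ∈ Ico 1 (n + 1), G.phGain j ρ ≤ G.CF := fun ρ hρ =>
      (Finset.sum_le_sum_of_subset_of_nonneg hsub fun j _ _ => hph0 j ρ).trans (hphs ρ (n + 1) hρ)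
    have h1 := hph _ (klband_klTorusNorm_nonneg (L := L) (k - k'))
    have h2 := hph _ (klband_klTorusNorm_nonneg (L := L) (k + k' - Qm))
    have hsq : 0 ≤ (P.Klam * U) ^ 2 := sq_nonneg _
    nlinarith
  -- (2) remainders (re-indexed to `j − 1 ∈ range n`)
  have herem : ∑ j ∈ Ico 1 (n + 1), eremBar G P Q U β L (j - 1) ≤
      (G.cloc * P.Klam ^ 2 * (1 - (4 : ℝ) ^ (-G.θ))⁻¹ + 2 * Q.CR * P.Klam ^ 3 * |U|) * U ^ 2 + ∑ j ∈ range n, Q.CL β j / L := by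
    rw [Finset.sum_Ico_eq_sum_range, show n + 1 - 1 = n from rfl]
    simp only [Nat.add_sub_cancel_left]
    exact eremBar_sum_le hG hP hQ U β L n
  -- (3) thermal layer
  have hth : ∑ j ∈ Ico 1 (n + 1), thermalBar G P U β j ≤ 7 / 3 * (G.CF * (P.Klam * U) ^ 2) :=
    (Finset.sum_le_sum_of_subset_of_nonneg hsub fun j _ _ => by unfold thermalBar; positivity).trans
      (klth_thermalBar_sum_le_succ hCF P U β hn)
  -- (4) leg dressing at the FLOWING count (frames frozen beyond `n`)
  have hleg : ∑ j ∈ Ico 1 (n + 1), legDressBarQ2 G P Q U j (legSliceCountT L β μ (klFlowFrameU L M β U μ j) j ![k', Qm - k', Qm - k, k]) ≤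
      20 * (Q.CR * ((P.Klam * U) ^ 2 + (P.Klam * |U|) ^ 3)) := by
    set Kf : ℕ → TrigPolyC4v := fun j => klFlowFrameU L M β U μ (min j n) with hKf
    have hrate' : ∀ j, frameDist (Kf (j + 1)) (Kf j) ≤ κ * klScale klE0 j := by
      intro j
      by_cases hj : j < n
      · have h1 : min (j + 1) n = j + 1 := min_eq_left (by omega)
        have h2 : min j n = j := min_eq_left hj.le
        simp only [hKf, h1, h2]
        exact hrate j hj
      · have h1 : min (j + 1) n = n := min_eq_right (by omega)
        have h2 : min j n = n := min_eq_right (by omega)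
        simp only [hKf, h1, h2, frameDist_self]
        exact mul_nonneg hκ0 (klth_klScale_pos j).le
    have hsum := legDressBarQ2_countT_flow_sum_le (L := L) G hK hCR U β μ Kf hκ0 hκ hrate' ![k', Qm - k', Qm - k, k] n
    have heq : ∀ j ∈ range (n + 1), legDressBarQ2 G P Q U j (legSliceCountT L β μ (klFlowFrameU L M β U μ j) j ![k', Qm - k', Qm - k, k]) =
        legDressBarQ2 G P Q U j (legSliceCountT L β μ (Kf j) j ![k', Qm - k', Qm - k, k]) := by
      intro j hj
      have h2 : min j n = j := min_eq_left (by simp only [Finset.mem_range] at hj; omega)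
      simp only [hKf, h2]
    refine (Finset.sum_le_sum_of_subset_of_nonneg hsub fun j _ _ => legDressBarQ2_nonneg G hK hCR U j _).trans ?_
    rw [Finset.sum_congr rfl heq]
    exact hsum
  -- (5) frame shift
  have hfs : ∑ j ∈ Ico 1 (n + 1), frameShiftBar P Q U j ≤ 4 / 3 * (Q.CR * (P.Klam * U) ^ 2) :=
    (Finset.sum_le_sum_of_subset_of_nonneg hsub fun j _ _ => frameShiftBar_nonneg (P := P) hCR U j).trans
      (sum_frameShiftBar_le hCR U (n + 1))
  linarith

/-- **The frame-rate law from (I-F jets)**: if the flow pieces `m ≤ j` have admissible jets (`FlowPieceJetsAt`, the renorm slot of the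
history) then `frameDist K_{j+1} K_j ≤ R.Gfr 0·|U|·4^{−2j}`. -/
theorem frameDist_klFlowFrameU_succ_le {j : ℕ} (hJ : ∀ m < j + 1, FlowPieceJetsAt L M β U μ R m) :
    frameDist (klFlowFrameU L M β U μ (j + 1)) (klFlowFrameU L M β U μ j) ≤
      R.Gfr 0 * uPow 0 U * (4 : ℝ) ^ ((((0 : ℕ) : ℤ) - 2) * (j : ℤ)) := by
  refine frameDist_le_of_forall fun p => ?_
  have h := abs_evalM_klFlowFrameU_sub_le (L := L) (M := M) (β := β) (U := U) (μ := μ) (R := R) (j := j) (n := j + 1)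
    (Nat.le_succ j) hJ (WithLp.toLp 2 p)
  rw [evalM_apply, evalM_apply, WithLp.ofLp_toLp] at h
  simpa [Finset.sum_Ico_succ_top le_rfl] using h

/-- … hence `≤ κ·Λ_j` as soon as `R.Gfr 0·|U| ≤ κ·klE0` (a `U₀(R)`-type smallness; `4^{−2j} ≤ 4^{−j}`). -/
theorem frameDist_klFlowFrameU_succ_le_rate {j : ℕ} (hJ : ∀ m < j + 1, FlowPieceJetsAt L M β U μ R m) (hG0 : 0 ≤ R.Gfr 0)
    {κ : ℝ} (hUκ : R.Gfr 0 * |U| ≤ κ * klE0) :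
    frameDist (klFlowFrameU L M β U μ (j + 1)) (klFlowFrameU L M β U μ j) ≤ κ * klScale klE0 j := by
  refine (frameDist_klFlowFrameU_succ_le hJ).trans ?_
  have h4 : (4 : ℝ) ^ ((((0 : ℕ) : ℤ) - 2) * (j : ℤ)) ≤ ((4 : ℝ) ^ j)⁻¹ := by
    rw [show (((0 : ℕ) : ℤ) - 2) * (j : ℤ) = -((2 * j : ℕ) : ℤ) by push_cast; ring, zpow_neg, zpow_natCast, pow_mul]
    refine inv_anti₀ (by positivity) ?_
    calc (4 : ℝ) ^ j ≤ (4 : ℝ) ^ j * (4 : ℝ) ^ j := le_mul_of_one_le_right (by positivity) (one_le_pow₀ (by norm_num))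
      _ = ((4 : ℝ) ^ 2) ^ j := by rw [← mul_pow]; norm_num
  have hu : uPow 0 U = |U| := by simp [uPow]
  rw [hu, klScale]
  have h1 : 0 ≤ R.Gfr 0 * |U| := mul_nonneg hG0 (abs_nonneg U)
  calc R.Gfr 0 * |U| * (4 : ℝ) ^ ((((0 : ℕ) : ℤ) - 2) * (j : ℤ)) ≤ R.Gfr 0 * |U| * ((4 : ℝ) ^ j)⁻¹ :=
        mul_le_mul_of_nonneg_left h4 h1
    _ ≤ κ * klE0 * ((4 : ℝ) ^ j)⁻¹ := mul_le_mul_of_nonneg_right hUκ (by positivity)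
    _ = κ * (klE0 * ((4 : ℝ) ^ j)⁻¹) := by ring

/-! ## §4 The assembled door -/

/-- **(E5-F)ₙ from the tower's single-tuple line and the value lane's flow data.**  Inputs: `hfix` (single iso-tuple size of 𝒱ₙ[Kₙ]
`≤ a·U + b·(Klam U)²` at every `m ≥ n`, with `2a ≤ CF`, `b ≤ CF`); the (E2-F2)₀ uv clause `h0`; the cross-frame increments
`PairValueIncrementAtV17F … j`, `1 ≤ j ≤ n`; two bare-ball points `q, q₃` with `4⁻¹ < |q + q₃|_𝕋` (pair momentum off the pair class at every
scale `≥ 1`); the frame-rate law below `n`; and ONE smallness line — the accumulated rows at `(q + q₃; q, q)` plus the uv deviation are `≤ U/2`. -/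
theorem isoTupleL1AtV17F_of_fixedTuple_le_of_flowValues (hG : G.WF) (hP : P.WF) (hQ : Q.WF) (hU : 0 < U) {n : ℕ}
    (hn : n ≤ nScales β + 1) {a b : ℝ}
    (hfix : ∀ m : ℕ, n ≤ m → ∀ Ω ∈ bgmSectorSet L M (klIsoFamily L M β μ (klFlowFrameU L M β U μ n) klE0 m) 4,
      ∀ x₁ : SpaceTimeIdx L M,
        fixedTupleL1 L M β 3 (klIsoKernelAt L M β U μ (klFlowFrameU L M β U μ n) n m) Ω x₁ ≤ a * U + b * (P.Klam * U) ^ 2)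
    (ha : 2 * a ≤ G.CF) (hb : b ≤ G.CF)
    (h0 : ∀ Qm : TorusSite 2 L, ∀ k ∈ klBall L μ 0, ∀ k' ∈ klBall L μ 0,
      ‖klPairAmplitude L M β U μ (klFlowFrameU L M β U μ 0) 0 Qm k k' - (U : ℂ)‖ ≤ initDevBar G U + legDressBarQ2 G P Q U 0 4)
    (hincr : ∀ j : ℕ, 1 ≤ j → j ≤ n → PairValueIncrementAtV17F L M G P Q β U μ j)
    {q q₃ : TorusSite 2 L} (hq : q ∈ klBall L μ 0) (hq₃ : q₃ ∈ klBall L μ 0) (hqq : 4⁻¹ < klTorusNorm L (q + q₃))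
    {κ : ℝ} (hκ0 : 0 ≤ κ) (hκ : κ ≤ 1 / 32)
    (hrate : ∀ j < n, frameDist (klFlowFrameU L M β U μ (j + 1)) (klFlowFrameU L M β U μ j) ≤ κ * klScale klE0 j)
    (hsmall : initDevBar G U + legDressBarQ2 G P Q U 0 4 +
        (3 * G.CF * (P.Klam * U) ^ 2 +
          ((G.cloc * P.Klam ^ 2 * (1 - (4 : ℝ) ^ (-G.θ))⁻¹ + 2 * Q.CR * P.Klam ^ 3 * |U|) * U ^ 2 + ∑ j ∈ range n, Q.CL β j / L) +
            7 / 3 * (G.CF * (P.Klam * U) ^ 2) + 20 * (Q.CR * ((P.Klam * U) ^ 2 + (P.Klam * |U|) ^ 3)) +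
              4 / 3 * (Q.CR * (P.Klam * U) ^ 2)) ≤ U / 2) :
    IsoTupleL1AtV17F L M G P β U μ n := by
  have hCF : 0 ≤ G.CF := hG.2.2.2.2.2.2.2.2.2.2.2.2.2.1
  -- the value lower bound at the triple `(q, q, q₃)`: `λ(q,q,q₃) = 𝒞(q+q₃; q, q)`
  have hrows := sum_pairValueRow_le (M := M) (μ := μ) hG hP hQ hn (q + q₃) q q hqq hκ0 hκ hrate
  have hge := norm_pairAmplitude_flow_ge_of_increments (G := G) (P := P) (Q := Q) hU.le n h0 hincr (q + q₃) hq hq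
  have hlow : 1 / 2 * U ≤ ‖klQuarticValue L M β U μ (klFlowFrameU L M β U μ n) n 0 1 q q q₃‖ := by
    rw [klka_quarticValue_eq_pairAmplitude]
    linarith
  exact isoTupleL1AtV17F_of_fixedTuple_le hU hCF hfix hq hq hq₃ hlow (by linarith) hb

/-- **(E5-F)ₙ keyed on the stub's HISTORY** (`1 ≤ n`): the uv clause is (E2-F2)₀'s first conjunct at `j = 0 < n` and the increments
`1 ≤ j < n` are the history's (E2″-F)ⱼ; the increment at `j = n` is the CURRENT (E2″-F)ₙ (in the (c) assembly it is derived before (E5-F)ₙ);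
the frame-rate law is discharged from the history's (I-F jets) and `R.Gfr 0·|U| ≤ klE0/32`.  The history may sit at any package `G'`
whose `initDevBar/legDressBarQ2/gainBar/eremBar/thermalBar` agree with `G`'s — here literally the same `G`. -/
theorem isoTupleL1AtV17F_of_fixedTuple_le_hist (hG : G.WF) (hP : P.WF) (hQ : Q.WF) (hR : R.WF) (hU : 0 < U) {n : ℕ} (hn1 : 1 ≤ n)
    (hn : n ≤ nScales β + 1) {a b : ℝ}
    (hfix : ∀ m : ℕ, n ≤ m → ∀ Ω ∈ bgmSectorSet L M (klIsoFamily L M β μ (klFlowFrameU L M β U μ n) klE0 m) 4,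
      ∀ x₁ : SpaceTimeIdx L M,
        fixedTupleL1 L M β 3 (klIsoKernelAt L M β U μ (klFlowFrameU L M β U μ n) n m) Ω x₁ ≤ a * U + b * (P.Klam * U) ^ 2)
    (ha : 2 * a ≤ G.CF) (hb : b ≤ G.CF)
    (hhist : HistP klPredsV17F2 L M G P Q R β U μ 0 n) (hE2'' : PairValueIncrementAtV17F L M G P Q β U μ n)
    {q q₃ : TorusSite 2 L} (hq : q ∈ klBall L μ 0) (hq₃ : q₃ ∈ klBall L μ 0) (hqq : 4⁻¹ < klTorusNorm L (q + q₃))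
    (hUκ : R.Gfr 0 * |U| ≤ 1 / 32 * klE0)
    (hsmall : initDevBar G U + legDressBarQ2 G P Q U 0 4 +
        (3 * G.CF * (P.Klam * U) ^ 2 +
          ((G.cloc * P.Klam ^ 2 * (1 - (4 : ℝ) ^ (-G.θ))⁻¹ + 2 * Q.CR * P.Klam ^ 3 * |U|) * U ^ 2 + ∑ j ∈ range n, Q.CL β j / L) +
            7 / 3 * (G.CF * (P.Klam * U) ^ 2) + 20 * (Q.CR * ((P.Klam * U) ^ 2 + (P.Klam * |U|) ^ 3)) +
              4 / 3 * (Q.CR * (P.Klam * U) ^ 2)) ≤ U / 2) :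
    IsoTupleL1AtV17F L M G P β U μ n := by
  have hh := (histP_klPredsV17F2_iff L M G P Q R β U μ 0 n).1 hhist
  -- (E2-F2)₀ uv clause from the history at `j = 0`
  have h0 : ∀ Qm : TorusSite 2 L, ∀ k ∈ klBall L μ 0, ∀ k' ∈ klBall L μ 0,
      ‖klPairAmplitude L M β U μ (klFlowFrameU L M β U μ 0) 0 Qm k k' - (U : ℂ)‖ ≤ initDevBar G U + legDressBarQ2 G P Q U 0 4 :=
    ((hh 0 (by omega)).2.2.1).2.2.1.1 rfl
  -- increments: history for `j < n`, the current clause at `j = n`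
  have hincr : ∀ j : ℕ, 1 ≤ j → j ≤ n → PairValueIncrementAtV17F L M G P Q β U μ j := by
    intro j hj1 hjn
    rcases Nat.lt_or_eq_of_le hjn with hlt | rfl
    · exact ((hh j hlt).2.2.1).2.2.2.1
    · exact hE2''
  -- frame rate from (I-F jets) of the history
  have hrate : ∀ j < n, frameDist (klFlowFrameU L M β U μ (j + 1)) (klFlowFrameU L M β U μ j) ≤ 1 / 32 * klScale klE0 j :=
    fun j hj => frameDist_klFlowFrameU_succ_le_rate (fun m hm => ((hh m (by omega)).2.1).2.1) (hR.2.2 0) hUκ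
  exact isoTupleL1AtV17F_of_fixedTuple_le_of_flowValues hG hP hQ hU hn hfix ha hb h0 hincr hq hq₃ hqq (by norm_num) le_rfl hrate hsmall

/-! ## §1′ (appended, plan g17 (R46)(β)) — the LINEAR absorption: one hypothesis `a + b·Klam²·U ≤ θ·CF` -/

/-- **(E5-F)ₙ, linear absorption** ((R46) §1′): as `isoTupleL1AtV17F_of_fixedTuple_le` but with the SINGLE constant condition
`a + b·P.Klam²·U ≤ θ·G.CF` — the whole tower line `a·U + b·(Klam U)² = (a + b·Klam²·U)·U` is absorbed through the value lower bound
`θ·U ≤ ‖λₙ[Kₙ]‖ ≤ B` (so a `P`/`R`-closed `b` of polynomial size is paid by `U`-smallness, not by `CF`). -/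
theorem isoTupleL1AtV17F_of_fixedTuple_le_linear (hU : 0 < U) (hCF : 0 ≤ G.CF) {a b θ : ℝ}
    (hfix : ∀ m : ℕ, n ≤ m → ∀ Ω ∈ bgmSectorSet L M (klIsoFamily L M β μ (klFlowFrameU L M β U μ n) klE0 m) 4,
      ∀ x₁ : SpaceTimeIdx L M,
        fixedTupleL1 L M β 3 (klIsoKernelAt L M β U μ (klFlowFrameU L M β U μ n) n m) Ω x₁ ≤ a * U + b * (P.Klam * U) ^ 2)
    {k₁ k₂ k₃ : TorusSite 2 L} (hk₁ : k₁ ∈ klBall L μ 0) (hk₂ : k₂ ∈ klBall L μ 0) (hk₃ : k₃ ∈ klBall L μ 0)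
    (hlow : θ * U ≤ ‖klQuarticValue L M β U μ (klFlowFrameU L M β U μ n) n 0 1 k₁ k₂ k₃‖)
    (hab : a + b * P.Klam ^ 2 * U ≤ θ * G.CF) :
    IsoTupleL1AtV17F L M G P β U μ n := by
  intro B _hB hvals m hm Ω hΩ x₁
  have hθB : θ * U ≤ B := hlow.trans (hvals k₁ hk₁ k₂ hk₂ k₃ hk₃)
  have h1 := hfix m hm Ω hΩ x₁
  have hsq : 0 ≤ G.CF * (P.Klam * U) ^ 2 := mul_nonneg hCF (sq_nonneg _)
  have h2 : a * U + b * (P.Klam * U) ^ 2 ≤ G.CF * B :=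
    calc a * U + b * (P.Klam * U) ^ 2 = (a + b * P.Klam ^ 2 * U) * U := by ring
      _ ≤ θ * G.CF * U := mul_le_mul_of_nonneg_right hab hU.le
      _ = G.CF * (θ * U) := by ring
      _ ≤ G.CF * B := mul_le_mul_of_nonneg_left hθB hCF
  linarith

/-- **The assembled door, linear absorption** (`θ = 1/2`): as `isoTupleL1AtV17F_of_fixedTuple_le_of_flowValues` with `a + b·Klam²·U ≤ CF/2`. -/
theorem isoTupleL1AtV17F_of_fixedTuple_le_linear_of_flowValues (hG : G.WF) (hP : P.WF) (hQ : Q.WF) (hU : 0 < U) {n : ℕ}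
    (hn : n ≤ nScales β + 1) {a b : ℝ}
    (hfix : ∀ m : ℕ, n ≤ m → ∀ Ω ∈ bgmSectorSet L M (klIsoFamily L M β μ (klFlowFrameU L M β U μ n) klE0 m) 4,
      ∀ x₁ : SpaceTimeIdx L M,
        fixedTupleL1 L M β 3 (klIsoKernelAt L M β U μ (klFlowFrameU L M β U μ n) n m) Ω x₁ ≤ a * U + b * (P.Klam * U) ^ 2)
    (hab : a + b * P.Klam ^ 2 * U ≤ G.CF / 2)
    (h0 : ∀ Qm : TorusSite 2 L, ∀ k ∈ klBall L μ 0, ∀ k' ∈ klBall L μ 0,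
      ‖klPairAmplitude L M β U μ (klFlowFrameU L M β U μ 0) 0 Qm k k' - (U : ℂ)‖ ≤ initDevBar G U + legDressBarQ2 G P Q U 0 4)
    (hincr : ∀ j : ℕ, 1 ≤ j → j ≤ n → PairValueIncrementAtV17F L M G P Q β U μ j)
    {q q₃ : TorusSite 2 L} (hq : q ∈ klBall L μ 0) (hq₃ : q₃ ∈ klBall L μ 0) (hqq : 4⁻¹ < klTorusNorm L (q + q₃))
    {κ : ℝ} (hκ0 : 0 ≤ κ) (hκ : κ ≤ 1 / 32)
    (hrate : ∀ j < n, frameDist (klFlowFrameU L M β U μ (j + 1)) (klFlowFrameU L M β U μ j) ≤ κ * klScale klE0 j)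
    (hsmall : initDevBar G U + legDressBarQ2 G P Q U 0 4 +
        (3 * G.CF * (P.Klam * U) ^ 2 +
          ((G.cloc * P.Klam ^ 2 * (1 - (4 : ℝ) ^ (-G.θ))⁻¹ + 2 * Q.CR * P.Klam ^ 3 * |U|) * U ^ 2 + ∑ j ∈ range n, Q.CL β j / L) +
            7 / 3 * (G.CF * (P.Klam * U) ^ 2) + 20 * (Q.CR * ((P.Klam * U) ^ 2 + (P.Klam * |U|) ^ 3)) +
              4 / 3 * (Q.CR * (P.Klam * U) ^ 2)) ≤ U / 2) :
    IsoTupleL1AtV17F L M G P β U μ n := by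
  have hCF : 0 ≤ G.CF := hG.2.2.2.2.2.2.2.2.2.2.2.2.2.1
  have hrows := sum_pairValueRow_le (M := M) (μ := μ) hG hP hQ hn (q + q₃) q q hqq hκ0 hκ hrate
  have hge := norm_pairAmplitude_flow_ge_of_increments (G := G) (P := P) (Q := Q) hU.le n h0 hincr (q + q₃) hq hq
  have hlow : 1 / 2 * U ≤ ‖klQuarticValue L M β U μ (klFlowFrameU L M β U μ n) n 0 1 q q q₃‖ := by
    rw [klka_quarticValue_eq_pairAmplitude]
    linarith
  exact isoTupleL1AtV17F_of_fixedTuple_le_linear hU hCF hfix hq hq hq₃ hlow (by linarith)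

/-- **History-keyed, linear absorption** (`1 ≤ n`; as `isoTupleL1AtV17F_of_fixedTuple_le_hist` with `a + b·Klam²·U ≤ CF/2`). -/
theorem isoTupleL1AtV17F_of_fixedTuple_le_linear_hist (hG : G.WF) (hP : P.WF) (hQ : Q.WF) (hR : R.WF) (hU : 0 < U) {n : ℕ}
    (hn1 : 1 ≤ n) (hn : n ≤ nScales β + 1) {a b : ℝ}
    (hfix : ∀ m : ℕ, n ≤ m → ∀ Ω ∈ bgmSectorSet L M (klIsoFamily L M β μ (klFlowFrameU L M β U μ n) klE0 m) 4,
      ∀ x₁ : SpaceTimeIdx L M,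
        fixedTupleL1 L M β 3 (klIsoKernelAt L M β U μ (klFlowFrameU L M β U μ n) n m) Ω x₁ ≤ a * U + b * (P.Klam * U) ^ 2)
    (hab : a + b * P.Klam ^ 2 * U ≤ G.CF / 2)
    (hhist : HistP klPredsV17F2 L M G P Q R β U μ 0 n) (hE2'' : PairValueIncrementAtV17F L M G P Q β U μ n)
    {q q₃ : TorusSite 2 L} (hq : q ∈ klBall L μ 0) (hq₃ : q₃ ∈ klBall L μ 0) (hqq : 4⁻¹ < klTorusNorm L (q + q₃))
    (hUκ : R.Gfr 0 * |U| ≤ 1 / 32 * klE0)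
    (hsmall : initDevBar G U + legDressBarQ2 G P Q U 0 4 +
        (3 * G.CF * (P.Klam * U) ^ 2 +
          ((G.cloc * P.Klam ^ 2 * (1 - (4 : ℝ) ^ (-G.θ))⁻¹ + 2 * Q.CR * P.Klam ^ 3 * |U|) * U ^ 2 + ∑ j ∈ range n, Q.CL β j / L) +
            7 / 3 * (G.CF * (P.Klam * U) ^ 2) + 20 * (Q.CR * ((P.Klam * U) ^ 2 + (P.Klam * |U|) ^ 3)) +
              4 / 3 * (Q.CR * (P.Klam * U) ^ 2)) ≤ U / 2) :
    IsoTupleL1AtV17F L M G P β U μ n := by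
  have hh := (histP_klPredsV17F2_iff L M G P Q R β U μ 0 n).1 hhist
  have h0 : ∀ Qm : TorusSite 2 L, ∀ k ∈ klBall L μ 0, ∀ k' ∈ klBall L μ 0,
      ‖klPairAmplitude L M β U μ (klFlowFrameU L M β U μ 0) 0 Qm k k' - (U : ℂ)‖ ≤ initDevBar G U + legDressBarQ2 G P Q U 0 4 :=
    ((hh 0 (by omega)).2.2.1).2.2.1.1 rfl
  have hincr : ∀ j : ℕ, 1 ≤ j → j ≤ n → PairValueIncrementAtV17F L M G P Q β U μ j := by
    intro j hj1 hjn
    rcases Nat.lt_or_eq_of_le hjn with hlt | rfl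
    · exact ((hh j hlt).2.2.1).2.2.2.1
    · exact hE2''
  have hrate : ∀ j < n, frameDist (klFlowFrameU L M β U μ (j + 1)) (klFlowFrameU L M β U μ j) ≤ 1 / 32 * klScale klE0 j :=
    fun j hj => frameDist_klFlowFrameU_succ_le_rate (fun m hm => ((hh m (by omega)).2.1).2.1) (hR.2.2 0) hUκ
  exact isoTupleL1AtV17F_of_fixedTuple_le_linear_of_flowValues hG hP hQ hU hn hfix hab h0 hincr hq hq₃ hqq (by norm_num) le_rfl hrate
    hsmall

end Model

end Summit.HubbardSuperconductivity.HubbardSuperconductivity.Theorems.KLRegimeSplit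

end
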